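import Literature.Geometry.Riemannian.DirichletEnergyEstimates
import Literature.Geometry.Riemannian.DirichletEnergyMinimisers
import Literature.Geometry.Riemannian.DirichletMinimiserHarmonic
import HarnessLib

/-!
# The weak Dirichlet problem on a domain with a Poincaré inequality (Dirichlet's principle)

The variational (`H¹₀`) solution of the Dirichlet problem used throughout the Cheeger–Colding
theory (harmonic replacement of a function `χ` on a ball, Cheeger–Colding 1996, §6; 2000, §1),
in the form this tree follows for Carron's minimisers (`DirichletEnergyMinimisers.lean`,
`DirichletMinimiserHarmonic.lean`), with the Sobolev inequality replaced by a **Poincaré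
(Friedrichs) inequality on the domain** (`DirichletPoincareBall.lean` supplies it for balls under
`Ric ≥ -(d-1)`). Let `(N, h)` be a Riemannian manifold modelled on `ℝ^m`, `U ⊆ N` any set, and
suppose `∫ v² ≤ C_P ∫ |dv|²_h` for all `v ∈ C_c^∞(N)` vanishing off `U`. For `χ ∈ C^∞(N)` with
compactly supported differential:

* `exists_dirichlet_minimising_limit_of_poincare` — there are the infimum `m` of
  `E(v) = ∫ |d(χ - v)|²_h` over `v ∈ C_c^∞(N)` vanishing off `U`, a minimising sequence `vₙ` in
  this class, and `w ∈ L²(dV_h)` with `‖vₙ - w‖_{L²} → 0` (parallelogram identity + Poincaré ⇒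
  Cauchy in `L²`) and asymptotically vanishing first variation
  `∫ h⁻¹(d(χ - vₙ), dζ) → 0` for every `ζ ∈ C_c^∞(N)` vanishing off `U`;
* `integral_sub_mul_dalembertian_eq_zero_of_tendsto` — then `u = χ - w` is **weakly harmonic in
  `U`**: `∫ (χ - w) Δ_h ζ dV_h = 0` for every such `ζ` (Green's identity for compactly supported
  `ζ` and `L²` convergence), and `w = 0` a.e. off `U` (`ae_eq_zero_of_tendsto_eLpNorm`), i.e.
  "`u = χ` on `∂U`" in the `H¹₀` sense;
* `exists_weak_dirichlet_solution_of_poincare` — the two combined.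

No definitions, no named facts (D-0026). Groundwork for `CheegerColding1997_sphereStability`
(block (II): harmonic approximations of distance functions).

## References

* J. Cheeger, T. H. Colding, Ann. of Math. 144 (1996) 189–237, §6; J. Differential Geom. 46
  (1997) 406–480, §1–§2. [CheegerColding1996] [CheegerColding1997]
* D. Gilbarg, N. Trudinger, *Elliptic PDE of second order*, Thm. 8.3 / §8.2 (Dirichlet's
  principle in `W^{1,2}_0`). [GilbargTrudinger2001]
* G. Carron, arXiv:0704.3194 (2007), Remark 2.6 (the variational route followed here). [Carron2007]
-/

noncomputable section

open Bundle Set Function Filter Topology MeasureTheory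
open scoped Manifold ContDiff ENNReal NNReal

namespace Literature.Geometry.Riemannian

open Literature.Geometry.Lorentzian
open Literature.Geometry.Lorentzian.PseudoRiemannianMetric

/-! ### §0 `L²` bookkeeping -/

section L2

variable {X : Type*} [MeasurableSpace X] {ν : Measure X}

/-- For `f ∈ L²` with `∫ f²` finite as a Bochner integral of an integrable function,
`‖f‖²_{L²} = ofReal (∫ f²)`. [folklore] -/
theorem eLpNorm_two_rpow_two_eq_ofReal_integral_sq {f : X → ℝ} (hf : AEStronglyMeasurable f ν)
    (hf2 : Integrable (fun x ↦ f x ^ 2) ν) :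
    eLpNorm f 2 ν ^ (2 : ℝ) = ENNReal.ofReal (∫ x, f x ^ 2 ∂ν) := by
  have _ := hf
  rw [eLpNorm_eq_lintegral_rpow_enorm_toReal (by norm_num) (by norm_num), ← ENNReal.rpow_mul]
  simp only [ENNReal.toReal_ofNat, one_div, isUnit_iff_ne_zero, ne_eq, OfNat.ofNat_ne_zero,
    not_false_eq_true, IsUnit.inv_mul_cancel, ENNReal.rpow_one]
  rw [ofReal_integral_eq_lintegral_ofReal hf2 (Eventually.of_forall fun x ↦ sq_nonneg (f x))]
  refine lintegral_congr_ae (Eventually.of_forall fun x ↦ ?_)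
  show ‖f x‖ₑ ^ (2 : ℝ) = ENNReal.ofReal (f x ^ 2)
  rw [Real.enorm_eq_ofReal_abs, ENNReal.ofReal_rpow_of_nonneg (abs_nonneg _) (by norm_num),
    Real.rpow_two, sq_abs]

/-- If `vₙ → w` in `L^q` and every `vₙ` vanishes on a measurable set `S`, then `w = 0` a.e. on `S`.
[folklore] -/
theorem ae_eq_zero_of_tendsto_eLpNorm {v : ℕ → X → ℝ} {w : X → ℝ} {q : ℝ≥0∞} (hq : q ≠ 0)
    (hw : AEStronglyMeasurable w ν)
    (hlim : Tendsto (fun n ↦ eLpNorm (v n - w) q ν) atTop (𝓝 0)) {S : Set X}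
    (hS : MeasurableSet S) (hvS : ∀ n, ∀ x ∈ S, v n x = 0) :
    ∀ᵐ x ∂ν, x ∈ S → w x = 0 := by
  -- `‖w 1_S‖_q ≤ ‖vₙ - w‖_q → 0`
  have hle : ∀ n, eLpNorm (S.indicator w) q ν ≤ eLpNorm (v n - w) q ν := by
    intro n
    refine eLpNorm_mono fun x ↦ ?_
    by_cases hx : x ∈ S
    · rw [indicator_of_mem hx, Pi.sub_apply, hvS n x hx, zero_sub, norm_neg]
    · rw [indicator_of_notMem hx, norm_zero]; exact norm_nonneg _
  have h0 : eLpNorm (S.indicator w) q ν = 0 := by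
    refine le_antisymm ?_ bot_le
    exact ge_of_tendsto hlim (Eventually.of_forall hle)
  have h1 := (eLpNorm_eq_zero_iff (hw.indicator hS) hq).1 h0
  filter_upwards [h1] with x hx hxS
  have : S.indicator w x = 0 := hx
  rwa [indicator_of_mem hxS] at this

end L2

/-! ### §1 Minimising sequences under a Poincaré inequality -/

section Minimisers

variable {E : Type*} [NormedAddCommGroup E] [NormedSpace ℝ E] [FiniteDimensional ℝ E]
  {H : Type*} [TopologicalSpace H] {I : ModelWithCorners ℝ E H} [I.Boundaryless]
  {X : Type*} [TopologicalSpace X] [ChartedSpace H X] [IsManifold I ∞ X]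
  [T3Space X] [MeasurableSpace X] [BorelSpace X]
  (h : ContMDiffRiemannianMetric I ∞ E (TangentSpace I : X → Type _))

/-- **First variation at an almost-minimiser, restricted class**: if `m ≤ E(w)` for all
`w ∈ C_c^∞` vanishing off `U`, then for `v, ζ` in this class
`(∫ h⁻¹(d(χ - v), dζ))² ≤ (E(v) - m) ∫ |dζ|²`. [cite: Carron2007, Remark 2.6] -/
theorem sq_integral_innerDual_le_of_forall_le_of_eqOn {χ v ζ : X → ℝ} (hχ : ContMDiff I 𝓘(ℝ, ℝ) ∞ χ)
    {K₁ : Set X} (hK₁ : IsCompact K₁) (hχK : ∀ x ∉ K₁, mvfderiv I χ x = 0) (U : Set X)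
    (hv : ContMDiff I 𝓘(ℝ, ℝ) ∞ v) (hvc : HasCompactSupport v) (hvU : ∀ x ∉ U, v x = 0)
    (hζ : ContMDiff I 𝓘(ℝ, ℝ) ∞ ζ) (hζc : HasCompactSupport ζ) (hζU : ∀ x ∉ U, ζ x = 0) {m : ℝ}
    (hmin : ∀ w : X → ℝ, ContMDiff I 𝓘(ℝ, ℝ) ∞ w → HasCompactSupport w → (∀ x ∉ U, w x = 0) →
      m ≤ ∫ x, (PseudoRiemannianMetric.ofRiemannian h).gradSq (χ - w) x ∂riemannianMeasure h) :
    (∫ x, (PseudoRiemannianMetric.ofRiemannian h).innerDual x (mvfderiv I (χ - v) x).toLinearMap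
        (mvfderiv I ζ x).toLinearMap ∂riemannianMeasure h) ^ 2 ≤
      ((∫ x, (PseudoRiemannianMetric.ofRiemannian h).gradSq (χ - v) x ∂riemannianMeasure h) - m) *
        ∫ x, (PseudoRiemannianMetric.ofRiemannian h).gradSq ζ x ∂riemannianMeasure h := by
  refine sq_le_mul_of_forall_le (integral_nonneg fun x ↦ innerDual_self_nonneg (h := h) x _)
    fun t ↦ ?_
  rw [← integral_gradSq_sub_add_smul h hχ hK₁ hχK hv hvc hζ hζc t]
  refine hmin _ (hv.add (contMDiff_const.mul hζ)) (hvc.add hζc.mul_left) fun x hx ↦ ?_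
  show v x + t * ζ x = 0
  rw [hvU x hx, hζU x hx, mul_zero, add_zero]

set_option maxHeartbeats 400000 in
/-- **Dirichlet's principle on a domain with a Poincaré inequality: the minimising sequence and
its `L²` limit.** Let `χ ∈ C^∞` have `dχ = 0` off a compact `K₁`, let `U ⊆ X`, and assume the
Poincaré inequality `∫ v² ≤ C_P ∫ |dv|²_h` for `v ∈ C_c^∞(X)` vanishing off `U`. Then there are
the infimum `m` of `E(v) = ∫ |d(χ - v)|²_h` over this class, a minimising sequence `vₙ` in the
class, and `w ∈ L²` with `‖vₙ - w‖_{L²} → 0` and `∫ h⁻¹(d(χ - vₙ), dζ) → 0` for every `ζ` in the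
class. [cite: GilbargTrudinger2001, §8.2] [cite: Carron2007, Remark 2.6] -/
theorem exists_dirichlet_minimising_limit_of_poincare {χ : X → ℝ} (hχ : ContMDiff I 𝓘(ℝ, ℝ) ∞ χ)
    {K₁ : Set X} (hK₁ : IsCompact K₁) (hχK : ∀ x ∉ K₁, mvfderiv I χ x = 0) (U : Set X) {CP : ℝ}
    (hP : ∀ v : X → ℝ, ContMDiff I 𝓘(ℝ, ℝ) ∞ v → HasCompactSupport v → (∀ x ∉ U, v x = 0) →
      ∫ x, v x ^ 2 ∂riemannianMeasure h ≤
        CP * ∫ x, (PseudoRiemannianMetric.ofRiemannian h).gradSq v x ∂riemannianMeasure h) :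
    ∃ (m : ℝ) (v : ℕ → X → ℝ) (w : X → ℝ),
      (∀ n, ContMDiff I 𝓘(ℝ, ℝ) ∞ (v n)) ∧ (∀ n, HasCompactSupport (v n)) ∧
      (∀ n, ∀ x ∉ U, v n x = 0) ∧
      (∀ u : X → ℝ, ContMDiff I 𝓘(ℝ, ℝ) ∞ u → HasCompactSupport u → (∀ x ∉ U, u x = 0) →
        m ≤ ∫ x, (PseudoRiemannianMetric.ofRiemannian h).gradSq (χ - u) x ∂riemannianMeasure h) ∧
      Tendsto (fun n ↦ ∫ x, (PseudoRiemannianMetric.ofRiemannian h).gradSq (χ - v n) x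
        ∂riemannianMeasure h) atTop (𝓝 m) ∧
      MemLp w 2 (riemannianMeasure h) ∧
      Tendsto (fun n ↦ eLpNorm (v n - w) 2 (riemannianMeasure h)) atTop (𝓝 0) ∧
      ∀ ζ : X → ℝ, ContMDiff I 𝓘(ℝ, ℝ) ∞ ζ → HasCompactSupport ζ → (∀ x ∉ U, ζ x = 0) →
        Tendsto (fun n ↦ ∫ x, (PseudoRiemannianMetric.ofRiemannian h).innerDual x
          (mvfderiv I (χ - v n) x).toLinearMap (mvfderiv I ζ x).toLinearMap ∂riemannianMeasure h)
          atTop (𝓝 0) := by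
  haveI : IsFiniteMeasureOnCompacts (riemannianMeasure h) :=
    ⟨fun K hK ↦ riemannianVolume_lt_top_of_isCompact_holds h le_rfl hK⟩
  set g := PseudoRiemannianMetric.ofRiemannian h with hgdef
  set ν : Measure X := riemannianMeasure h with hν
  -- the energy functional on test functions
  set En : (X → ℝ) → ℝ := fun u ↦ ∫ x, g.gradSq (χ - u) x ∂ν with hEn
  have hEn_nonneg : ∀ u, 0 ≤ En u := fun u ↦
    integral_nonneg fun x ↦ innerDual_self_nonneg (h := h) x _
  -- the infimum `m` over the class
  set S : Set ℝ := {e | ∃ u : X → ℝ, ContMDiff I 𝓘(ℝ, ℝ) ∞ u ∧ HasCompactSupport u ∧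
    (∀ x ∉ U, u x = 0) ∧ En u = e} with hSdef
  have hSne : S.Nonempty := ⟨En 0, 0, contMDiff_const, HasCompactSupport.zero, fun _ _ ↦ rfl, rfl⟩
  have hSbdd : BddBelow S := ⟨0, fun e ⟨u, _, _, _, he⟩ ↦ he ▸ hEn_nonneg u⟩
  set m : ℝ := sInf S with hm
  have hmle : ∀ u : X → ℝ, ContMDiff I 𝓘(ℝ, ℝ) ∞ u → HasCompactSupport u → (∀ x ∉ U, u x = 0) →
      m ≤ En u :=
    fun u hu huc huU ↦ csInf_le hSbdd ⟨u, hu, huc, huU, rfl⟩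
  -- a minimising sequence
  obtain ⟨e, -, he, heS⟩ := exists_seq_tendsto_sInf hSne hSbdd
  choose v₀ hv₀s hv₀c hv₀U hv₀e using heS
  have hEv₀ : Tendsto (fun n ↦ En (v₀ n)) atTop (𝓝 m) := by
    simp only [hv₀e]; exact he
  -- energies of differences tend to zero (parallelogram identity)
  have hdiff : ∀ ε : ℝ, 0 < ε → ∃ N : ℕ, ∀ n k : ℕ, N ≤ n → N ≤ k →
      ∫ x, g.gradSq (v₀ n - v₀ k) x ∂ν < ε := by
    intro ε hε
    have hev : ∀ᶠ n in atTop, En (v₀ n) < m + ε / 4 :=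
      (tendsto_order.1 hEv₀).2 _ (by linarith)
    obtain ⟨N, hN⟩ := eventually_atTop.1 hev
    refine ⟨N, fun n k hn hk ↦ ?_⟩
    have hpar := integral_gradSq_sub_sub_parallelogram h hχ hK₁ hχK (hv₀s n) (hv₀c n) (hv₀s k) (hv₀c k)
    have hmid : m ≤ En (fun y ↦ (1 / 2 : ℝ) * (v₀ n y + v₀ k y)) :=
      hmle _ (contMDiff_const.mul ((hv₀s n).add (hv₀s k))) (((hv₀c n).add (hv₀c k)).mul_left)
        fun x hx ↦ by
          show (1 / 2 : ℝ) * (v₀ n x + v₀ k x) = 0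
          rw [hv₀U n x hx, hv₀U k x hx]; ring
    have h1 := hN n hn
    have h2 := hN k hk
    change ∫ x, g.gradSq (v₀ n - v₀ k) x ∂ν = 2 * En (v₀ n) + 2 * En (v₀ k) -
      4 * En (fun y ↦ (1 / 2 : ℝ) * (v₀ n y + v₀ k y)) at hpar
    linarith
  -- the `L²` Cauchy property from the Poincaré inequality
  have hsq_int : ∀ n k : ℕ, Integrable (fun x ↦ (v₀ n - v₀ k) x ^ 2) ν := by
    intro n k
    have hc2 : Continuous fun x ↦ (v₀ n - v₀ k) x ^ 2 := ((hv₀s n).sub (hv₀s k)).continuous.pow 2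
    have hcs2 : HasCompactSupport fun x ↦ (v₀ n - v₀ k) x ^ 2 := by
      refine HasCompactSupport.of_support_subset_isCompact ((hv₀c n).sub (hv₀c k)).isCompact
        fun x hx ↦ subset_tsupport _ ?_
      rw [mem_support] at hx ⊢
      exact fun h0 ↦ hx (by rw [h0]; ring)
    exact hc2.integrable_of_hasCompactSupport hcs2
  have hL2 : ∀ n k : ℕ, eLpNorm (v₀ n - v₀ k) 2 ν ^ (2 : ℝ) ≤
      ENNReal.ofReal (max CP 0 * ∫ x, g.gradSq (v₀ n - v₀ k) x ∂ν) := by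
    intro n k
    have hPnk := hP (v₀ n - v₀ k) ((hv₀s n).sub (hv₀s k)) ((hv₀c n).sub (hv₀c k)) fun x hx ↦ by
      show v₀ n x - v₀ k x = 0
      rw [hv₀U n x hx, hv₀U k x hx, sub_zero]
    rw [eLpNorm_two_rpow_two_eq_ofReal_integral_sq (f := v₀ n - v₀ k)
      (((hv₀s n).sub (hv₀s k)).continuous.aestronglyMeasurable) (hsq_int n k)]
    refine ENNReal.ofReal_le_ofReal (hPnk.trans ?_)
    exact mul_le_mul_of_nonneg_right (le_max_left _ _)
      (integral_nonneg fun x ↦ innerDual_self_nonneg (h := h) x _)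
  have hcau : ∀ j : ℕ, ∃ N : ℕ, ∀ n k : ℕ, N ≤ n → N ≤ k →
      eLpNorm (v₀ n - v₀ k) 2 ν < (2⁻¹ : ℝ≥0∞) ^ j := by
    intro j
    set δ : ℝ := ((1 / 2 : ℝ) ^ j) ^ 2 with hδ
    have hδpos : 0 < δ := by positivity
    obtain ⟨N, hN⟩ := hdiff (δ / (2 * (max CP 0 + 1))) (by positivity)
    refine ⟨N, fun n k hn hk ↦ ?_⟩
    have h1 := hL2 n k
    have hM0 : 0 ≤ max CP 0 := le_max_right _ _
    have h2 : max CP 0 * ∫ x, g.gradSq (v₀ n - v₀ k) x ∂ν < δ := by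
      have := hN n k hn hk
      have hI0 : 0 ≤ ∫ x, g.gradSq (v₀ n - v₀ k) x ∂ν :=
        integral_nonneg fun x ↦ innerDual_self_nonneg (h := h) x _
      calc max CP 0 * ∫ x, g.gradSq (v₀ n - v₀ k) x ∂ν
          ≤ (max CP 0 + 1) * ∫ x, g.gradSq (v₀ n - v₀ k) x ∂ν :=
            mul_le_mul_of_nonneg_right (by linarith) hI0
        _ ≤ (max CP 0 + 1) * (δ / (2 * (max CP 0 + 1))) :=
            mul_le_mul_of_nonneg_left this.le (by positivity)
        _ = δ / 2 := by field_simp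
        _ < δ := by linarith
    have h3 : eLpNorm (v₀ n - v₀ k) 2 ν ^ (2 : ℝ) < ENNReal.ofReal δ :=
      lt_of_le_of_lt h1 ((ENNReal.ofReal_lt_ofReal_iff hδpos).2 h2)
    have h4 : eLpNorm (v₀ n - v₀ k) 2 ν < ENNReal.ofReal δ ^ (1 / 2 : ℝ) := by
      have := ENNReal.rpow_lt_rpow h3 (by norm_num : (0 : ℝ) < 1 / 2)
      rwa [← ENNReal.rpow_mul, show (2 : ℝ) * (1 / 2) = 1 by norm_num, ENNReal.rpow_one] at this
    refine h4.trans_eq ?_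
    rw [hδ, ENNReal.ofReal_pow (by positivity), ← ENNReal.rpow_natCast, ← ENNReal.rpow_mul,
      show ((2 : ℕ) : ℝ) * (1 / 2) = 1 by norm_num, ENNReal.rpow_one,
      ENNReal.ofReal_pow (by positivity), ENNReal.ofReal_div_of_pos two_pos, ENNReal.ofReal_one,
      ENNReal.ofReal_ofNat, one_div]
  -- pass to a subsequence with geometric rate and take the `L²` limit
  obtain ⟨ψ, hψge, hψ⟩ := exists_subseq_rate hcau
  set v : ℕ → X → ℝ := fun j ↦ v₀ (ψ j) with hvdef
  have hvmem : ∀ j, MemLp (v j) 2 ν := fun j ↦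
    (hv₀s (ψ j)).continuous.memLp_of_hasCompactSupport (hv₀c (ψ j))
  have hB : ∑' J : ℕ, (2⁻¹ : ℝ≥0∞) ^ J ≠ ⊤ := by
    rw [ENNReal.tsum_geometric]
    simp
  obtain ⟨w, hwmem, hwlim⟩ := MeasureTheory.Lp.cauchy_complete_eLpNorm (μ := ν) (by norm_num) hvmem hB
    (fun J j l hJj hJl ↦ hψ J j l hJj hJl)
  have hψtop : Tendsto ψ atTop atTop := tendsto_atTop_mono hψge tendsto_id
  refine ⟨m, v, w, fun j ↦ hv₀s _, fun j ↦ hv₀c _, fun j ↦ hv₀U _, hmle, hEv₀.comp hψtop, hwmem,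
    hwlim, ?_⟩
  -- the first variation vanishes in the limit
  intro ζ hζ hζc hζU
  set C : ℝ := ∫ x, g.gradSq ζ x ∂ν with hC
  have hbound : ∀ j, |∫ x, g.innerDual x (mvfderiv I (χ - v j) x).toLinearMap
      (mvfderiv I ζ x).toLinearMap ∂ν| ≤ Real.sqrt ((En (v j) - m) * C) := by
    intro j
    have hsq := sq_integral_innerDual_le_of_forall_le_of_eqOn h hχ hK₁ hχK U (hv₀s (ψ j))
      (hv₀c (ψ j)) (hv₀U (ψ j)) hζ hζc hζU (m := m) hmle
    rw [← Real.sqrt_sq (abs_nonneg _), sq_abs]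
    exact Real.sqrt_le_sqrt hsq
  have hlim : Tendsto (fun j ↦ Real.sqrt ((En (v j) - m) * C)) atTop (𝓝 0) := by
    have h1 : Tendsto (fun j ↦ (En (v j) - m) * C) atTop (𝓝 ((m - m) * C)) :=
      (((hEv₀.comp hψtop).sub tendsto_const_nhds).mul tendsto_const_nhds)
    rw [sub_self, zero_mul] at h1
    have h2 := (Real.continuous_sqrt.tendsto 0).comp h1
    rwa [Function.comp_def, Real.sqrt_zero] at h2
  exact squeeze_zero_norm (fun j ↦ by rw [Real.norm_eq_abs]; exact hbound j) hlim

end Minimisers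

/-! ### §2 The limit is weakly harmonic in `U` -/

section Harmonic

variable {m : ℕ} {H : Type*} [TopologicalSpace H]
  {I : ModelWithCorners ℝ (EuclideanSpace ℝ (Fin m)) H} [I.Boundaryless]
  {N : Type*} [TopologicalSpace N] [ChartedSpace H N] [IsManifold I ∞ N]
  [T3Space N] [SecondCountableTopology N] [MeasurableSpace N] [BorelSpace N]
  (h : ContMDiffRiemannianMetric I ∞ (EuclideanSpace ℝ (Fin m)) (TangentSpace I : N → Type _))
  [(ofRiemannian h).HasLeviCivita]

/-- **The `L^q` limit of an asymptotically critical sequence is weakly harmonic, one test function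
at a time** (`integral_sub_mul_dalembertian_eq_zero` with the first-variation hypothesis only for
the given `ζ`): if `vₙ ∈ C_c^∞`, `vₙ → w` in `L^q` (`q ≥ 1`), `ζ ∈ C_c^∞` and
`∫ h⁻¹(d(χ - vₙ), dζ) → 0`, then `∫ (χ - w) Δ_h ζ dV_h = 0`. [cite: Carron2007, Remark 2.6] -/
theorem integral_sub_mul_dalembertian_eq_zero_of_tendsto {χ : N → ℝ} (hχ : ContMDiff I 𝓘(ℝ, ℝ) ∞ χ)
    {v : ℕ → N → ℝ} (hv : ∀ n, ContMDiff I 𝓘(ℝ, ℝ) ∞ (v n)) (hvc : ∀ n, HasCompactSupport (v n))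
    {q : ℝ≥0∞} (hq1 : 1 ≤ q) {w : N → ℝ} (hw : MemLp w q (riemannianMeasure h))
    (hlim : Tendsto (fun n ↦ eLpNorm (v n - w) q (riemannianMeasure h)) atTop (𝓝 0))
    {ζ : N → ℝ} (hζ : ContMDiff I 𝓘(ℝ, ℝ) ∞ ζ) (hζc : HasCompactSupport ζ)
    (hvar : Tendsto (fun n ↦ ∫ x, (ofRiemannian h).innerDual x (mvfderiv I (χ - v n) x).toLinearMap
        (mvfderiv I ζ x).toLinearMap ∂riemannianMeasure h) atTop (𝓝 0)) :
    ∫ x, (χ x - w x) * (ofRiemannian h).dalembertian ζ x ∂riemannianMeasure h = 0 := by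
  haveI : LocallyCompactSpace N := Manifold.locallyCompact_of_finiteDimensional I
  set ν : Measure N := riemannianMeasure h with hν
  haveI : IsFiniteMeasureOnCompacts ν :=
    ⟨fun K hK ↦ riemannianVolume_lt_top_of_isCompact_holds h le_rfl hK⟩
  set F : N → ℝ := (ofRiemannian h).dalembertian ζ with hF
  have hζ2 : CMDiff 2 ζ := by exact_mod_cast contMDiff_infty.1 hζ 2
  have hFc : Continuous F := continuous_dalembertian _ hζ2
  have hFsupp : ∀ x ∉ tsupport ζ, F x = 0 := fun x hx ↦
    dalembertian_eq_zero_of_notMem_tsupport _ hx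
  have hFcs : HasCompactSupport F :=
    HasCompactSupport.of_support_subset_isCompact hζc.isCompact fun x hx ↦ by
      by_contra hx'; exact hx (hFsupp x hx')
  obtain ⟨C, hC⟩ := hFcs.exists_bound_of_continuous hFc
  have hFC : ∀ x, |F x| ≤ max C 0 := fun x ↦
    (Real.norm_eq_abs (F x) ▸ hC x).trans (le_max_left _ _)
  have hgreen : ∀ n, ∫ x, (χ x - v n x) * F x ∂ν =
      -∫ x, (ofRiemannian h).innerDual x (mvfderiv I (χ - v n) x).toLinearMap
        (mvfderiv I ζ x).toLinearMap ∂ν := by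
    intro n
    have hu1 : CMDiff 1 (χ - v n) := by exact_mod_cast contMDiff_infty.1 (hχ.sub (hv n)) 1
    exact integral_mul_dalembertian_eq_neg_integral_innerDual_of_hasCompactSupport_right h
      hu1 hζ2 hζc
  have hT1 : Tendsto (fun n ↦ ∫ x, (χ x - v n x) * F x ∂ν) atTop (𝓝 0) := by
    have h0 := hvar.neg
    rw [neg_zero] at h0
    exact h0.congr fun n ↦ (hgreen n).symm
  have hvq : ∀ n, MemLp (v n) q ν := fun n ↦
    (hv n).continuous.memLp_of_hasCompactSupport (hvc n)
  obtain ⟨hIprod, hT2⟩ := tendsto_integral_sub_mul_of_tendsto_eLpNorm (ν := ν) hq1 hvq hw hlim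
    (isClosed_tsupport ζ).measurableSet hζc.isCompact.measure_lt_top (le_max_right C 0) hFC
    hFsupp hFc.aestronglyMeasurable
  have hIn : ∀ n, Integrable (fun x ↦ (χ x - v n x) * F x) ν := fun n ↦
    (((hχ.sub (hv n)).continuous.mul hFc).integrable_of_hasCompactSupport hFcs.mul_left)
  have hsum : ∀ n, ∫ x, (χ x - w x) * F x ∂ν =
      (∫ x, (χ x - v n x) * F x ∂ν) + ∫ x, (v n x - w x) * F x ∂ν := by
    intro n
    rw [← integral_add (hIn n) (hIprod n)]
    refine integral_congr_ae (Eventually.of_forall fun x ↦ ?_)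
    ring
  have hconst : Tendsto (fun n : ℕ ↦ ∫ x, (χ x - w x) * F x ∂ν) atTop (𝓝 (0 + 0)) :=
    (hT1.add hT2).congr fun n ↦ (hsum n).symm
  rw [add_zero] at hconst
  exact tendsto_nhds_unique tendsto_const_nhds hconst

/-- **The weak solution of the Dirichlet problem on a domain with a Poincaré inequality**
(Dirichlet's principle): for `χ ∈ C^∞(N)` with `dχ = 0` off a compact set and `U ⊆ N` carrying
the Poincaré inequality `∫ v² ≤ C_P ∫ |dv|²_h` on `C_c^∞` functions vanishing off `U`, there is
`w ∈ L²(dV_h)` with `w = 0` a.e. off `U` (boundary values `χ` in the `H¹₀` sense: `w` is the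
`L²` limit of `C_c^∞` functions vanishing off `U` with convergent Dirichlet energies) such that
`u = χ - w` is weakly harmonic in `U`: `∫ (χ - w) Δ_h ζ dV_h = 0` for all `ζ ∈ C_c^∞(N)` vanishing
off `U`. [cite: GilbargTrudinger2001, §8.2] [cite: CheegerColding1996, §6] -/
theorem exists_weak_dirichlet_solution_of_poincare {χ : N → ℝ} (hχ : ContMDiff I 𝓘(ℝ, ℝ) ∞ χ)
    {K₁ : Set N} (hK₁ : IsCompact K₁) (hχK : ∀ x ∉ K₁, mvfderiv I χ x = 0) {U : Set N}
    (hU : MeasurableSet U) {CP : ℝ}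
    (hP : ∀ v : N → ℝ, ContMDiff I 𝓘(ℝ, ℝ) ∞ v → HasCompactSupport v → (∀ x ∉ U, v x = 0) →
      ∫ x, v x ^ 2 ∂riemannianMeasure h ≤
        CP * ∫ x, (ofRiemannian h).gradSq v x ∂riemannianMeasure h) :
    ∃ (w : N → ℝ) (v : ℕ → N → ℝ) (mE : ℝ), MemLp w 2 (riemannianMeasure h) ∧
      (∀ᵐ x ∂riemannianMeasure h, x ∉ U → w x = 0) ∧
      (∀ n, ContMDiff I 𝓘(ℝ, ℝ) ∞ (v n)) ∧ (∀ n, HasCompactSupport (v n)) ∧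
      (∀ n, ∀ x ∉ U, v n x = 0) ∧
      Tendsto (fun n ↦ eLpNorm (v n - w) 2 (riemannianMeasure h)) atTop (𝓝 0) ∧
      (∀ u : N → ℝ, ContMDiff I 𝓘(ℝ, ℝ) ∞ u → HasCompactSupport u → (∀ x ∉ U, u x = 0) →
        mE ≤ ∫ x, (ofRiemannian h).gradSq (χ - u) x ∂riemannianMeasure h) ∧
      Tendsto (fun n ↦ ∫ x, (ofRiemannian h).gradSq (χ - v n) x ∂riemannianMeasure h)
        atTop (𝓝 mE) ∧
      ∀ ζ : N → ℝ, ContMDiff I 𝓘(ℝ, ℝ) ∞ ζ → HasCompactSupport ζ → (∀ x ∉ U, ζ x = 0) →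
        ∫ x, (χ x - w x) * (ofRiemannian h).dalembertian ζ x ∂riemannianMeasure h = 0 := by
  obtain ⟨mE, v, w, hvs, hvc, hvU, hmle, hEv, hwmem, hwlim, hvar⟩ :=
    exists_dirichlet_minimising_limit_of_poincare h hχ hK₁ hχK U hP
  refine ⟨w, v, mE, hwmem, ?_, hvs, hvc, hvU, hwlim, hmle, hEv, fun ζ hζ hζc hζU ↦ ?_⟩
  · have h0 := ae_eq_zero_of_tendsto_eLpNorm (by norm_num) hwmem.aestronglyMeasurable hwlim hU.compl
      (fun n x hx ↦ hvU n x hx)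
    filter_upwards [h0] with x hx hxU using hx hxU
  · exact integral_sub_mul_dalembertian_eq_zero_of_tendsto h hχ hvs hvc (by norm_num) hwmem hwlim hζ
      hζc (hvar ζ hζ hζc hζU)

end Harmonic

end Literature.Geometry.Riemannian

end
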